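import Mathlib
import HarnessLib
import Summits.ValiantsHypothesis.ValiantsHypothesis.Theorems.LacunarySymmetroidMatrixDescartesInertiaIndexTelescope
import Summits.ValiantsHypothesis.ValiantsHypothesis.Theorems.LacunarySymmetroidMatrixDescartesInertiaJump

/-!
# Route «KPlusLogSqLaw», `WeakLifting` (stmt-ValiantsHypothesis-19561) — mixed-gauge series / inertia kit: THE REFINED WINDOW INEQUALITY —
# with ONE-SIDED jump bounds at the singular points (no non-degeneracy), `ν(F b) + 2·Σ u_t ≤ ν(F a) + Σ k_t`

HONEST FRAMING.  Helper file (hand leafhand-val-kpluslogsqlaw-1 g14, 2026-08-31; `--supports stmt-ValiantsHypothesis-19561 --as helper`,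
zero crux / stub credit).  General point-set bookkeeping for an entrywise-continuous hermitian family `F : ℝ → Matrix ι ι ℝ`, the
INEQUALITY companion of val-sym-mdr-p2's index telescope `Inertia.negIndex_telescope` (`…InertiaIndexTelescope`: EXACT one-sided jumps)
and of the window inequality `Inertia.negIndex_le_add_sum_corank` (`…InertiaWindow`: jumps bounded by the corank only).  Data: a finite set
`T` containing the singular points of `F` in `[a, b]`, non-singular ends `a < b`, and at every `t ∈ T ∩ (a, b)` ONE-SIDED bounds
`ν(F t) + u t ≤ ν(F x)` for `x < t` near `t` and `ν(F x) + u t ≤ ν(F t) + k t` for `x > t` near `t`.  Conclusion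
(`negIndex_refined_window`): **`ν(F b) + 2·Σ_{T ∩ (a,b)} u t ≤ ν(F a) + Σ_{T ∩ (a,b)} k t`**.  WHY: this is step (U1) of the located
two-class mixed-gauge law `ζ ≤ n + 2m` at every ratio (evidence memo evidence-g14-mixed-gauge-all-ratios.md on the item): at a root `t`
carrying a POSITIVE kernel family of size `u t` the kit's one-sided family laws (`Inertia.eventually_negIndex_ge_add_left`,
`Inertia.eventually_posIndex_ge_add_right`, no non-degeneracy) give exactly these two bounds with `k t = dim ker F(t)`; the refined
window then bounds the total positive-type mass `Σ u_t` by the end inertias plus `Σ (k_t − u_t)`, which the FAMILY DOWNWARD LAW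
(`MixedGauge.family_card_le_blocks`) caps by `m`.  The proof is the kit's telescope induction verbatim with `=` replaced by the two
inequalities (`Inertia.exists_point_left/right`, `Inertia.sum_filter_Ioo_split3`, `Inertia.negIndex_eq_of_noRoot_Icc`).  Nothing here is
about `WeakLifting` / `TropicalB` in their windows, the registered stubs, the doors, `MatrixDescartes` (18050) or VP ≠ VNP.  No `def`;
axioms standard. [folklore]
-/

set_option linter.dupNamespace false
set_option autoImplicit false

namespace Summit.ValiantsHypothesis.ValiantsHypothesis.Theorems.LacunarySymmetroidMatrixDescartes

open Matrix Finset
open scoped BigOperators Topology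

namespace Inertia

variable {ι : Type} [Fintype ι] [DecidableEq ι]

/-- Induction engine of the refined window inequality (on the number of interior singular points). [folklore] -/
theorem negIndex_refined_window_aux (F : ℝ → Matrix ι ι ℝ) (hF : ∀ i j, Continuous fun x => F x i j)
    (hH : ∀ x, (F x).IsHermitian) (T : Finset ℝ) (u k : ℝ → ℕ) :
    ∀ (n : ℕ) (a b : ℝ), a < b → (T.filter (fun t => a < t ∧ t < b)).card ≤ n →
      (∀ x ∈ Set.Icc a b, (F x).det = 0 → x ∈ T) → (F a).det ≠ 0 → (F b).det ≠ 0 →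
      (∀ t ∈ T, a < t → t < b → ∀ᶠ x in 𝓝[>] t,
          Fintype.card {j // (hH x).eigenvalues j < 0} + u t ≤ Fintype.card {j // (hH t).eigenvalues j < 0} + k t) →
      (∀ t ∈ T, a < t → t < b → ∀ᶠ x in 𝓝[<] t,
          Fintype.card {j // (hH t).eigenvalues j < 0} + u t ≤ Fintype.card {j // (hH x).eigenvalues j < 0}) →
      Fintype.card {j // (hH b).eigenvalues j < 0} + 2 * ∑ t ∈ T.filter (fun t => a < t ∧ t < b), u t
        ≤ Fintype.card {j // (hH a).eigenvalues j < 0} + ∑ t ∈ T.filter (fun t => a < t ∧ t < b), k t := by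
  intro n
  induction n with
  | zero =>
    intro a b hab hcard hT ha hb _ _
    have hemp : T.filter (fun t => a < t ∧ t < b) = ∅ := Finset.card_eq_zero.1 (Nat.le_zero.1 hcard)
    rw [hemp, Finset.sum_empty, Finset.sum_empty, mul_zero, add_zero, add_zero]
    refine le_of_eq (negIndex_eq_of_noRoot_Icc F hF hH hab.le fun x hx hdet => ?_)
    rcases eq_or_lt_of_le hx.1 with rfl | hax
    · exact ha hdet
    rcases eq_or_lt_of_le hx.2 with rfl | hxb
    · exact hb hdet
    have : x ∈ T.filter (fun t => a < t ∧ t < b) := Finset.mem_filter.2 ⟨hT x hx hdet, hax, hxb⟩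
    rw [hemp] at this
    simp at this
  | succ n ih =>
    intro a b hab hcard hT ha hb hjr hjl
    by_cases hne : (T.filter (fun t => a < t ∧ t < b)).Nonempty
    · obtain ⟨t₀, ht₀⟩ := hne
      obtain ⟨ht₀T, hat₀, ht₀b⟩ := Finset.mem_filter.1 ht₀
      -- realising scales on both sides of `t₀`
      obtain ⟨a', haa', ha't, ha'v, hgapl⟩ := exists_point_left T hat₀ (hjl t₀ ht₀T hat₀ ht₀b)
      obtain ⟨b', htb', hb'b, hb'v, hgapr⟩ := exists_point_right T ht₀b (hjr t₀ ht₀T hat₀ ht₀b)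
      have ha'T : a' ∉ T := fun h => hgapl a' h le_rfl ha't
      have hb'T : b' ∉ T := fun h => hgapr b' h htb' le_rfl
      have ha'det : (F a').det ≠ 0 := fun h => ha'T (hT a' ⟨haa'.le, by linarith⟩ h)
      have hb'det : (F b').det ≠ 0 := fun h => hb'T (hT b' ⟨by linarith, hb'b.le⟩ h)
      -- the sub-windows carry fewer singular points
      have hsub1 : T.filter (fun t => a < t ∧ t < a') ⊆ (T.filter (fun t => a < t ∧ t < b)).erase t₀ := by
        intro t ht
        obtain ⟨htT, h1, h2⟩ := Finset.mem_filter.1 ht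
        exact Finset.mem_erase.2 ⟨ne_of_lt (lt_trans h2 ha't), Finset.mem_filter.2 ⟨htT, h1, by linarith⟩⟩
      have hsub2 : T.filter (fun t => b' < t ∧ t < b) ⊆ (T.filter (fun t => a < t ∧ t < b)).erase t₀ := by
        intro t ht
        obtain ⟨htT, h1, h2⟩ := Finset.mem_filter.1 ht
        exact Finset.mem_erase.2 ⟨(ne_of_lt (lt_trans htb' h1)).symm, Finset.mem_filter.2 ⟨htT, by linarith, h2⟩⟩
      have hce := Finset.card_erase_of_mem ht₀
      have hc1 : (T.filter (fun t => a < t ∧ t < a')).card ≤ n := by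
        have := Finset.card_le_card hsub1; omega
      have hc2 : (T.filter (fun t => b' < t ∧ t < b)).card ≤ n := by
        have := Finset.card_le_card hsub2; omega
      have h1 := ih a a' haa' hc1 (fun x hx hdx => hT x ⟨hx.1, by linarith [hx.2]⟩ hdx) ha ha'det
        (fun t ht h1 h2 => hjr t ht h1 (by linarith)) (fun t ht h1 h2 => hjl t ht h1 (by linarith))
      have h2 := ih b' b hb'b hc2 (fun x hx hdx => hT x ⟨by linarith [hx.1], hx.2⟩ hdx) hb'det hb
        (fun t ht h1 h2 => hjr t ht (by linarith) h2) (fun t ht h1 h2 => hjl t ht (by linarith) h2)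
      rw [sum_filter_Ioo_split3 T u haa' ha't htb' hb'b ht₀T hgapl hgapr,
        sum_filter_Ioo_split3 T k haa' ha't htb' hb'b ht₀T hgapl hgapr]
      -- `ha'v : ν(F t₀) + u t₀ ≤ ν(F a')`, `hb'v : ν(F b') + u t₀ ≤ ν(F t₀) + k t₀`
      omega
    · rw [Finset.not_nonempty_iff_eq_empty] at hne
      exact ih a b hab (by rw [hne]; simp) hT ha hb hjr hjl

/-- **THE REFINED WINDOW INEQUALITY (negative index).**  `F` entrywise continuous and hermitian, `a < b` non-singular scales, `T` a
finite set containing every singular point of `F` in `[a, b]`, and at every `t ∈ T ∩ (a, b)` the one-sided bounds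
`ν(F x) + u t ≤ ν(F t) + k t` for `x > t` near `t` and `ν(F t) + u t ≤ ν(F x)` for `x < t` near `t`.  Then
`ν(F b) + 2·Σ_{T ∩ (a,b)} u ≤ ν(F a) + Σ_{T ∩ (a,b)} k`. [folklore] -/
theorem negIndex_refined_window (F : ℝ → Matrix ι ι ℝ) (hF : ∀ i j, Continuous fun x => F x i j)
    (hH : ∀ x, (F x).IsHermitian) (T : Finset ℝ) (u k : ℝ → ℕ) {a b : ℝ} (hab : a < b)
    (hT : ∀ x ∈ Set.Icc a b, (F x).det = 0 → x ∈ T) (ha : (F a).det ≠ 0) (hb : (F b).det ≠ 0)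
    (hjr : ∀ t ∈ T, a < t → t < b → ∀ᶠ x in 𝓝[>] t,
      Fintype.card {j // (hH x).eigenvalues j < 0} + u t ≤ Fintype.card {j // (hH t).eigenvalues j < 0} + k t)
    (hjl : ∀ t ∈ T, a < t → t < b → ∀ᶠ x in 𝓝[<] t,
      Fintype.card {j // (hH t).eigenvalues j < 0} + u t ≤ Fintype.card {j // (hH x).eigenvalues j < 0}) :
    Fintype.card {j // (hH b).eigenvalues j < 0} + 2 * ∑ t ∈ T.filter (fun t => a < t ∧ t < b), u t
      ≤ Fintype.card {j // (hH a).eigenvalues j < 0} + ∑ t ∈ T.filter (fun t => a < t ∧ t < b), k t :=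
  negIndex_refined_window_aux F hF hH T u k _ a b hab le_rfl hT ha hb hjr hjl

/-- **One-sided bounds from a POSITIVE kernel family** (the form the located two-class law uses): for `F x = F x₀ + (x − x₀) • G x`
hermitian with `G` entrywise continuous and a kernel family `n : β → ℝ^ι` of `F x₀` on whose non-trivial combinations `G x₀` is
positive, `ν(F x₀) + card β ≤ ν(F x)` for `x < x₀` near `x₀` (the kit's `eventually_negIndex_ge_add_left`) and
`ν(F x) + card β ≤ ν(F x₀) + corank F(x₀)` for `x > x₀` near `x₀` (from `eventually_posIndex_ge_add_right` and
`ν + π + corank = card ι`, `ν(x) + π(x) ≤ card ι`). [folklore] -/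
theorem eventually_negIndex_add_le_right_of_posFamily {β : Type} [Fintype β] (F G : ℝ → Matrix ι ι ℝ) (x₀ : ℝ)
    (hG : ∀ i j, Continuous fun x => G x i j) (hFG : ∀ x, F x = F x₀ + (x - x₀) • G x)
    (hH : ∀ x, (F x).IsHermitian) (nv : β → ι → ℝ) (hn0 : ∀ j, F x₀ *ᵥ nv j = 0)
    (hn : ∀ c : β → ℝ, c ≠ 0 → 0 < (∑ j, c j • nv j) ⬝ᵥ (G x₀ *ᵥ ∑ j, c j • nv j)) :
    ∀ᶠ x in 𝓝[>] x₀, Fintype.card {j // (hH x).eigenvalues j < 0} + Fintype.card β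
      ≤ Fintype.card {j // (hH x₀).eigenvalues j < 0} + (Fintype.card ι - (F x₀).rank) := by
  have h := eventually_posIndex_ge_add_right F G x₀ hG hFG hH nv hn0 hn
  refine h.mono fun x hx => ?_
  have h₀ := negIndex_add_posIndex_add_corank (hH x₀)
  have hx' := negIndex_add_posIndex_add_corank (hH x)
  omega

end Inertia

end Summit.ValiantsHypothesis.ValiantsHypothesis.Theorems.LacunarySymmetroidMatrixDescartes
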